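import Mathlib

/-!
# Route LevelSetModeration — `LevelSetEnergyInequality`: a regularising sequence (helper file 2)

Support lemma for item stmt-NavierStokesRegularity-18151. To differentiate the Lipschitz truncation
weight `k₀ = (1 - c/|u|)₊` of Vasseur's level-set energy method (Vasseur 2007, (12)) inside the
viscous term we compose it with smooth functions `hₙ : ℝ → ℝ` that vanish near `0` and tend to the
identity: `hₙ(y) = (y - εₙ) ρ((n+1)y - 1)`, `εₙ = 1/(n+1)`, `ρ = Real.smoothTransition`. This file
records the (only) properties used downstream as one existence statement.

## References
* A. F. Vasseur, NoDEA 14 (2007), Lemma 11, (12). [Vasseur2007]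
-/

noncomputable section

-- single-conjunct summit: `Summit.<Summit>.<Problem>` repeats the name by the D-0017 layout
set_option linter.dupNamespace false

namespace Summit.NavierStokesRegularity.NavierStokesRegularity.Theorems.LevelSetEnergyInequality

open Real Set Filter Topology

/-- **A regularising sequence for the identity on `[0, ∞)`**: functions `hₙ` with derivatives
`hₙ'`, continuous, vanishing on a neighbourhood of `(-∞, 0]`, with `0 ≤ hₙ(y) ≤ y` for `y ≥ 0`,
`|hₙ'| ≤ M` uniformly, and `hₙ(y) → y`, `hₙ'(y) → 1` for every `y > 0`
(`hₙ(y) = (y - εₙ) ρ((n+1) y - 1)` with Mathlib's `Real.smoothTransition`). -/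
theorem exists_regularisation :
    ∃ (h h' : ℕ → ℝ → ℝ) (M : ℝ),
      (∀ n y, HasDerivAt (h n) (h' n y) y) ∧
      (∀ n, Continuous (h n)) ∧ (∀ n, Continuous (h' n)) ∧
      (∀ n, ∃ δ : ℝ, 0 < δ ∧ ∀ y, y ≤ δ → h n y = 0 ∧ h' n y = 0) ∧
      (∀ n y, 0 ≤ y → 0 ≤ h n y ∧ h n y ≤ y) ∧
      (∀ n y, |h' n y| ≤ M) ∧
      (∀ y, 0 < y → Tendsto (fun n => h n y) atTop (𝓝 y)) ∧
      (∀ y, 0 < y → Tendsto (fun n => h' n y) atTop (𝓝 1)) := by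
  -- a bound for `ρ'` on `[0, 1]`, `ρ = Real.smoothTransition`
  have hρdiff : Differentiable ℝ Real.smoothTransition :=
    (Real.smoothTransition.contDiff (n := 1)).differentiable one_ne_zero
  have hρ'cont : Continuous (deriv Real.smoothTransition) :=
    (Real.smoothTransition.contDiff (n := 1)).continuous_deriv le_rfl
  obtain ⟨C, hC⟩ := isCompact_Icc.exists_bound_of_continuousOn (s := Icc (0 : ℝ) 1)
    hρ'cont.continuousOn
  have hC0 : 0 ≤ C := (norm_nonneg _).trans (hC 0 ⟨le_rfl, zero_le_one⟩)
  -- `ρ' = 0` off `[0, 1]`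
  have hρ'neg : ∀ a : ℝ, a < 0 → deriv Real.smoothTransition a = 0 := fun a ha => by
    have hev : Real.smoothTransition =ᶠ[𝓝 a] fun _ => (0 : ℝ) := by
      filter_upwards [Iio_mem_nhds ha] with b hb
      exact Real.smoothTransition.zero_of_nonpos (le_of_lt hb)
    rw [hev.deriv_eq, deriv_const]
  have hρ'big : ∀ a : ℝ, 1 < a → deriv Real.smoothTransition a = 0 := fun a ha => by
    have hev : Real.smoothTransition =ᶠ[𝓝 a] fun _ => (1 : ℝ) := by
      filter_upwards [Ioi_mem_nhds ha] with b hb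
      exact Real.smoothTransition.one_of_one_le (le_of_lt hb)
    rw [hev.deriv_eq, deriv_const]
  -- the sequence
  set ε : ℕ → ℝ := fun n => ((n : ℝ) + 1)⁻¹ with hε
  have hεpos : ∀ n, 0 < ε n := fun n => by positivity
  have hεmul : ∀ n : ℕ, ((n : ℝ) + 1) * ε n = 1 := fun n => by
    rw [hε]; field_simp
  set h : ℕ → ℝ → ℝ := fun n y => (y - ε n) * Real.smoothTransition (((n : ℝ) + 1) * y - 1)
    with hh
  set h' : ℕ → ℝ → ℝ := fun n y =>
    Real.smoothTransition (((n : ℝ) + 1) * y - 1) +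
      (y - ε n) * (((n : ℝ) + 1) * deriv Real.smoothTransition (((n : ℝ) + 1) * y - 1))
    with hh'
  -- the key algebraic identity `(y - εₙ)(n+1) = (n+1) y - 1`
  have hkey : ∀ (n : ℕ) (y : ℝ), (y - ε n) * ((n : ℝ) + 1) = ((n : ℝ) + 1) * y - 1 := fun n y => by
    have := hεmul n
    rw [sub_mul, mul_comm (ε n), this, mul_comm]
  have hderiv : ∀ (n : ℕ) (y : ℝ), HasDerivAt (h n) (h' n y) y := fun n y => by
    have h1 : HasDerivAt (fun y : ℝ => y - ε n) 1 y := (hasDerivAt_id y).sub_const _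
    have h2 : HasDerivAt (fun y : ℝ => ((n : ℝ) + 1) * y - 1) ((n : ℝ) + 1) y := by
      simpa using ((hasDerivAt_id y).const_mul ((n : ℝ) + 1)).sub_const 1
    have h3 : HasDerivAt (fun y : ℝ => Real.smoothTransition (((n : ℝ) + 1) * y - 1))
        (deriv Real.smoothTransition (((n : ℝ) + 1) * y - 1) * ((n : ℝ) + 1)) y :=
      (hρdiff _).hasDerivAt.comp y h2
    have h4 := h1.mul h3
    have heq : 1 * Real.smoothTransition (((n : ℝ) + 1) * y - 1) +
        (y - ε n) * (deriv Real.smoothTransition (((n : ℝ) + 1) * y - 1) * ((n : ℝ) + 1)) =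
          h' n y := by
      simp only [hh']; ring
    rw [heq] at h4
    exact h4
  refine ⟨h, h', 1 + C, hderiv, ?_, ?_, ?_, ?_, ?_, ?_, ?_⟩
  · intro n
    exact (continuous_id.sub continuous_const).mul
      (Real.smoothTransition.continuous.comp ((continuous_const.mul continuous_id).sub continuous_const))
  · intro n
    refine (Real.smoothTransition.continuous.comp
      ((continuous_const.mul continuous_id).sub continuous_const)).add ?_
    exact (continuous_id.sub continuous_const).mul
      (continuous_const.mul (hρ'cont.comp ((continuous_const.mul continuous_id).sub continuous_const)))
  · -- vanishing near `0`: `δ = εₙ / 2`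
    intro n
    refine ⟨ε n / 2, by positivity, fun y hy => ?_⟩
    have ha : ((n : ℝ) + 1) * y - 1 < 0 := by
      have h1 : ((n : ℝ) + 1) * y ≤ ((n : ℝ) + 1) * (ε n / 2) :=
        mul_le_mul_of_nonneg_left hy (by positivity)
      have h2 : ((n : ℝ) + 1) * (ε n / 2) = 1 / 2 := by
        rw [mul_div_assoc', hεmul n]
      linarith
    refine ⟨?_, ?_⟩
    · show (y - ε n) * Real.smoothTransition (((n : ℝ) + 1) * y - 1) = 0
      rw [Real.smoothTransition.zero_of_nonpos ha.le, mul_zero]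
    · show Real.smoothTransition (((n : ℝ) + 1) * y - 1) +
        (y - ε n) * (((n : ℝ) + 1) * deriv Real.smoothTransition (((n : ℝ) + 1) * y - 1)) = 0
      rw [Real.smoothTransition.zero_of_nonpos ha.le, hρ'neg _ ha, mul_zero, mul_zero, add_zero]
  · -- `0 ≤ hₙ(y) ≤ y` for `y ≥ 0`
    intro n y hy
    show 0 ≤ (y - ε n) * Real.smoothTransition (((n : ℝ) + 1) * y - 1) ∧
      (y - ε n) * Real.smoothTransition (((n : ℝ) + 1) * y - 1) ≤ y
    rcases lt_or_ge y (ε n) with hlt | hge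
    · have ha : ((n : ℝ) + 1) * y - 1 < 0 := by
        have := mul_lt_mul_of_pos_left hlt (show (0 : ℝ) < (n : ℝ) + 1 by positivity)
        rw [hεmul n] at this
        linarith
      rw [Real.smoothTransition.zero_of_nonpos ha.le, mul_zero]
      exact ⟨le_rfl, hy⟩
    · have h0 : 0 ≤ y - ε n := sub_nonneg.2 hge
      refine ⟨mul_nonneg h0 (Real.smoothTransition.nonneg _), ?_⟩
      calc (y - ε n) * Real.smoothTransition (((n : ℝ) + 1) * y - 1) ≤ (y - ε n) * 1 :=
            mul_le_mul_of_nonneg_left (Real.smoothTransition.le_one _) h0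
        _ ≤ y := by linarith [hεpos n]
  · -- `|hₙ'| ≤ 1 + C`
    intro n y
    show |Real.smoothTransition (((n : ℝ) + 1) * y - 1) +
        (y - ε n) * (((n : ℝ) + 1) * deriv Real.smoothTransition (((n : ℝ) + 1) * y - 1))| ≤ 1 + C
    set a : ℝ := ((n : ℝ) + 1) * y - 1 with ha
    have hya : (y - ε n) * (((n : ℝ) + 1) * deriv Real.smoothTransition a) =
        a * deriv Real.smoothTransition a := by
      rw [← mul_assoc, hkey n y]
    rw [hya]
    have hρa : |Real.smoothTransition a| ≤ 1 := by
      rw [abs_of_nonneg (Real.smoothTransition.nonneg _)]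
      exact Real.smoothTransition.le_one _
    rcases lt_or_ge a 0 with hlt | hge
    · rw [hρ'neg a hlt, mul_zero, add_zero]
      linarith
    rcases le_or_gt a 1 with hle | hgt
    · have hda : |deriv Real.smoothTransition a| ≤ C := by
        have := hC a ⟨hge, hle⟩
        rwa [Real.norm_eq_abs] at this
      have haa : |a| ≤ 1 := abs_le.2 ⟨by linarith, hle⟩
      calc |Real.smoothTransition a + a * deriv Real.smoothTransition a|
          ≤ |Real.smoothTransition a| + |a * deriv Real.smoothTransition a| := abs_add_le _ _
        _ = |Real.smoothTransition a| + |a| * |deriv Real.smoothTransition a| := by rw [abs_mul]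
        _ ≤ 1 + 1 * C := by gcongr
        _ = 1 + C := by ring
    · rw [hρ'big a hgt, mul_zero, add_zero]
      linarith
  · -- `hₙ(y) → y`
    intro y hy
    have hev : ∀ᶠ n : ℕ in atTop, h n y = y - ε n := by
      have ht : Tendsto (fun n : ℕ => ((n : ℝ) + 1) * y - 1) atTop atTop :=
        tendsto_atTop_add_const_right _ _
          ((tendsto_natCast_atTop_atTop.atTop_add tendsto_const_nhds).atTop_mul_const hy)
      filter_upwards [ht.eventually_ge_atTop 1] with n hn
      show (y - ε n) * Real.smoothTransition (((n : ℝ) + 1) * y - 1) = y - ε n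
      rw [Real.smoothTransition.one_of_one_le hn, mul_one]
    have hlim : Tendsto (fun n : ℕ => y - ε n) atTop (𝓝 y) := by
      have h0 : Tendsto ε atTop (𝓝 0) :=
        tendsto_inv_atTop_zero.comp (tendsto_natCast_atTop_atTop.atTop_add tendsto_const_nhds)
      simpa using (tendsto_const_nhds (x := y)).sub h0
    exact hlim.congr' (hev.mono fun n hn => hn.symm)
  · -- `hₙ'(y) → 1`
    intro y hy
    have hev : ∀ᶠ n : ℕ in atTop, h' n y = 1 := by
      have ht : Tendsto (fun n : ℕ => ((n : ℝ) + 1) * y - 1) atTop atTop :=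
        tendsto_atTop_add_const_right _ _
          ((tendsto_natCast_atTop_atTop.atTop_add tendsto_const_nhds).atTop_mul_const hy)
      filter_upwards [ht.eventually_gt_atTop 1] with n hn
      show Real.smoothTransition (((n : ℝ) + 1) * y - 1) +
        (y - ε n) * (((n : ℝ) + 1) * deriv Real.smoothTransition (((n : ℝ) + 1) * y - 1)) = 1
      rw [Real.smoothTransition.one_of_one_le hn.le, hρ'big _ hn, mul_zero, mul_zero, add_zero]
    exact tendsto_const_nhds.congr' (hev.mono fun n hn => hn.symm)

end Summit.NavierStokesRegularity.NavierStokesRegularity.Theorems.LevelSetEnergyInequality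

end
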